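import Literature.NumberTheory.EllipticCurves.Selmer
import Literature.NumberTheory.EllipticCurves.AnalyticRank
import Literature.NumberTheory.EllipticCurves.SelmerParityTotallyReal
import Literature.NumberTheory.EllipticCurves.ComplexMultiplicationDeuringOrdinarySplit
import HarnessLib

/-!
# Crux `PlecticLegs.PlecticPointsLB` (stmt-BirchSwinnertonDyer-17518), line `Sketch` rev 2 —
# stub 3 `stub_parityOrdinary`: `p`-parity at good ordinary primes over totally real fields,
# from Nekovář 2013 Thm A and Deuring's criterion

Registered stub 3 of `Cruxes/PlecticPointsLB/Lines/Sketch.lean` (rev 2). For `F` totally real, `V/F` elliptic with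
ENTIRE `L`-function and a prime `p` above which `V` has good ordinary reduction at every `𝔭` (Mathlib's
`localPolynomial` of degree `2` with `p ∤ a_𝔭`): `corank_{ℤ_p} Sel_{p^∞}(V/F) ≡ ord_{s=1} L(V/F,s) (mod 2)` — GIVEN the
two named facts `Literature.NumberTheory.EllipticCurves.Nekovar2013_theoremA` (J. Nekovář, Algebra & Number Theory 7
(2013) 1101–1120, Thm A; landed p164451) and
`Literature.NumberTheory.EllipticCurves.Deuring1941_nonempty_geomEndRing_ringHom_padicInt_of_ordinary` (ordinary
reduction above `p` splits `p` in the CM field; p164475), which enter as the stub's own hypotheses (the line's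
literature debt, stub 1 `stub_printedEngines`). Proof (worker B of wave 1, `Lines/Sketch_stub_parity.lean`): a
non-CM curve is case (1) of Theorem A, a CM curve is case (3) by Deuring
(`selmerCorank_mod_two_eq_analyticRank_of_hasCM_imp`, `nonempty_geomEndRing_ringHom_padicInt_of_forall_ordinary`).
-/

set_option linter.dupNamespace false -- single-conjunct summit: Sub = Summit (D-0017)

open NumberField IsDedekindDomain

namespace Summit.BirchSwinnertonDyer.BirchSwinnertonDyer.Theorems

open Literature.NumberTheory.EllipticCurves

/-- **Stub 3 · `stub_parityOrdinary` (line `Sketch`, rev 2).** Nekovář 2013 Thm A and Deuring's criterion imply: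
for `F` totally real, `V/F` elliptic, `p` prime with good ordinary reduction at every `𝔭 ∣ p`, and `L(V/F,s)` entire,
`corank_{ℤ_p} Sel_{p^∞}(V/F) ≡ ord_{s=1} L(V/F,s) (mod 2)`. [cite: Nekovar2013, Thm. A] -/
theorem stub_parityOrdinary :
    Nekovar2013_theoremA → Deuring1941_nonempty_geomEndRing_ringHom_padicInt_of_ordinary →
    ∀ (F : Type) [Field F] [NumberField F] [NumberField.IsTotallyReal F] (V : WeierstrassCurve F)
      [V.IsElliptic] (p : ℕ) [Fact p.Prime],
      (∀ 𝔭 : HeightOneSpectrum (𝓞 F), (p : 𝓞 F) ∈ 𝔭.asIdeal →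
        ((V.baseChange (𝔭.adicCompletion F)).localPolynomial (𝔭.adicCompletionIntegers F)).natDegree = 2 ∧
        ¬ (p : ℤ) ∣ ((V.baseChange (𝔭.adicCompletion F)).localPolynomial
          (𝔭.adicCompletionIntegers F)).coeff 1) →
      V.HasEntireLFunction → V.selmerCorank p % 2 = V.analyticRank % 2 := by
  intro hN hD F _ _ _ V _ p _ hord hL
  exact selmerCorank_mod_two_eq_analyticRank_of_hasCM_imp V p hN
    (fun hCM => nonempty_geomEndRing_ringHom_padicInt_of_forall_ordinary hD V hCM p hord) hL

end Summit.BirchSwinnertonDyer.BirchSwinnertonDyer.Theorems
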